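import Summits.Langlands.Langlands.Theses.SkinnerWilesDefectOne
import Summits.Langlands.Langlands.Theorems.SkinnerWilesDefectOneProModularOrdinaryClassicalCentralDiamondWeight
import Summits.Langlands.Langlands.Theorems.SkinnerWilesDefectOneProModularOrdinaryClassicalSatakeDictionary
import Summits.Langlands.Langlands.Theorems.SkinnerWilesDefectOneProModularOrdinaryClassicalDominantGlue
import Summits.Langlands.Langlands.Theorems.SkinnerWilesDefectOneProModularOrdinaryClassicalDominantPointsClassical
import Literature.NumberTheory.Automorphic.BianchiOrdinaryClassicality

/-!
# The EXIT from a dominant ordinary point (crux `SkinnerWilesDefectOne.ProModularOrdinaryClassical`,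
stmt-Langlands-12921, line `top-degree-exact-control`): composition of the four landed stubs

Support file for the crux (it does not close it).  The line's kernel-checked composition shows that the crux
`ProModularOrdinaryClassical` is (OF⁺) followed by a Hecke-side exit; the four Hecke-side stubs are LANDED
(`stub_centralDiamondWeight` p85822, `stub_dominantOfCentralAndSlotZero` p89308, `stub_dominantPointsClassical` p89646,
`stub_satakeDictionary` p86662).  This file assembles them ONCE, as importable theorems whose hypotheses are exactly
the OUTPUT SHAPE of the transfer slot, so that (a) the planner's recommended retyping of the engine / exit (crux NOTES §3:
engine output = a point of Hida's ordinary algebra `𝕋^{S,ord}(𝒰)` of DOMINANT weight, as Skinner–Wiles' own notion of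
pro-modularity is) has its exit available as a one-line `exact`, and (b) any other line producing a dominant ordinary
point (the `paskunas-centre-split` lever, the `ordinary-patching-by-regime` engine output) plugs into the same tail.

* `classical_of_dominantDiamondWeightPoint` — for `F` imaginary quadratic, `p` odd, `ρ` irreducible and ordinary of the
  parallel weight `k ≥ 2` (exponent `m > 0`) at every `v ∣ p`, a CONTINUOUS `ℚ̄_p`-point `x` of `𝕋^{S,ord}(𝒰)` (`𝒰` maximal
  above `p`) associated with `ρ` and of DOMINANT arithmetic diamond weight `k` (`TameLevel.HasDominantDiamondWeight`)
  yields an L-algebraic cuspidal `π` on `GL₂(𝔸_F)` with the summit's Satake–Frobenius matching a.e. — GRANTING the three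
  printed Bianchi facts `hidaControl_dominantOrdinaryPoint`, `bianchi_interiorEigenclass_isCuspidal`,
  `bianchi_boundaryEigensystem_isReducible` of `Literature/NumberTheory/Automorphic/BianchiOrdinaryClassicality.lean`
  (conditional result; the facts are literature debt).
* `classical_of_slotZeroFiniteOrdinaryPoint` — the same from the WEAKER point datum that (OF⁺) outputs: slot `0` of the
  diamond character of finite order on global units above `p` (the centre weight `2 - k` is automatic for every associated
  point, `stub_centralDiamondWeight`; glue `stub_dominantOfCentralAndSlotZero`).
* `proModularOrdinaryClassical_of_ordinaryFactorisationDominant` — hence the crux follows from the three facts and the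
  transfer statement (OF⁺) `∀ ρ …, ∃ 𝒰 x N, …` (spelled out as a hypothesis; it is the line's registered open stub, an open
  problem as of 2026-08 — OF-dossier.md — and NOT asserted here).

References: the landed stub files' docstrings; [Hida1994AIF, Thm. 2.2, 3.1–3.2]; [KhareThorne2017, §6.4–6.5];
[Harder1987]; [SkinnerWiles1999, §3, Prop. 3.7 shape of the exit].
-/

namespace Summit.Langlands.Langlands.Theorems.SkinnerWilesDefectOne.ProModularOrdinaryClassicalExit

set_option linter.dupNamespace false

open Summit.Langlands.Langlands.Theses.SkinnerWilesDefectOne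
open Summit.Langlands.Langlands.Cruxes.ProModularOrdinaryClassical.TopDegreeExactControl
open Literature.NumberTheory.Automorphic Literature.NumberTheory.GaloisRepresentations
open Literature.NumberTheory.Automorphic.BigHeckeGLn
open NumberField IsDedekindDomain Filter

/-- **Exit from a DOMINANT ordinary point** (granting the three printed Bianchi facts): a continuous `ℚ̄_p`-point of
`𝕋^{S,ord}(𝒰)` (`𝒰` maximal above `p`) of dominant arithmetic diamond weight `k ≥ 2`, associated with an irreducible
`ρ` that is ordinary of parallel weight `k` (exponent `m > 0`) at every `v ∣ p`, is carried by an L-algebraic cuspidal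
`π` on `GL₂(𝔸_F)` with Satake–Frobenius matching at almost all places (`F` imaginary quadratic, `p` odd).  Composition of
the landed `stub_dominantPointsClassical` (Hida/Khare–Thorne control in the top degree, interior = cuspidal, boundary
eigensystems reducible) and `stub_satakeDictionary` (`π = (π₀ ⊗ ω⁻¹) ⊗ |det|^{1/2}`).
[cite: Hida1994AIF, Thm. 3.2] [cite: KhareThorne2017, §6.4, Cor. 6.15] [cite: Harder1987] -/
theorem classical_of_dominantDiamondWeightPoint
    (hA : Literature.NumberTheory.Automorphic.hidaControl_dominantOrdinaryPoint)
    (hB : Literature.NumberTheory.Automorphic.bianchi_interiorEigenclass_isCuspidal)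
    (hC : Literature.NumberTheory.Automorphic.bianchi_boundaryEigensystem_isReducible)
    (F : Type) [Field F] [NumberField F] (hF : IsTotallyComplex F) (hdeg : Module.finrank ℚ F = 2)
    (p : ℕ) [Fact p.Prime] (hp : p ≠ 2) (hcpt : isCompact_glFiniteIntegralLevel 2 F) (ι : PadicAlgCl p ≃+* ℂ)
    (ρ : FramedGaloisRep F (PadicAlgCl p) 2) (𝒰 : TameLevel 2 F p)
    (x : OrdinaryHeckeAlgebraGLn 𝒰 →+* PadicAlgCl p) (k m : ℕ)
    (hirr : ρ.toGaloisRep.IsIrreducible) (h𝒰 : 𝒰.IsMaximalAbove) (hx : Continuous x)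
    (hass : 𝒰.IsOrdAssociated x ρ) (hk : 2 ≤ k) (hm : 0 < m)
    (hv : ∀ v : HeightOneSpectrum (𝓞 F), (p : 𝓞 F) ∈ v.asIdeal → ρ.IsOrdinaryOfWeightAt p v k m)
    (hdom : 𝒰.HasDominantDiamondWeight x k) :
    ∃ π : CuspidalAutomorphicRepData 2 F hcpt, π.1.IsLAlgebraic ∧
      ∀ᶠ v in cofinite, Summit.Langlands.SatakeFrobCompatibleAt ι π.1 ρ v := by
  obtain ⟨π₀, hreg, hmatch⟩ :=
    stub_dominantPointsClassical hA hB hC F hF hdeg p hp hcpt ι ρ 𝒰 x k m hirr h𝒰 hx hass hk hm hv hdom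
  exact stub_satakeDictionary F hF hdeg p hp hcpt ι ρ 𝒰 x π₀ hass hreg hmatch

/-- **Exit from an ordinary point with FINITE-ORDER SLOT `0`** (the output shape of the transfer slot (OF⁺); granting the
three printed Bianchi facts): as `classical_of_dominantDiamondWeightPoint`, but assuming only that slot `0` of the diamond
character of `x` is killed by some `N ≥ 1` on global units above `p`; the centre weight `2 - k` holds at EVERY associated
point (`stub_centralDiamondWeight`, landed) and the glue `stub_dominantOfCentralAndSlotZero` gives dominance.
[cite: Hida1994AIF, §1 (p. 1293)] [cite: KhareThorne2017, §6.4, Cor. 6.15] -/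
theorem classical_of_slotZeroFiniteOrdinaryPoint
    (hA : Literature.NumberTheory.Automorphic.hidaControl_dominantOrdinaryPoint)
    (hB : Literature.NumberTheory.Automorphic.bianchi_interiorEigenclass_isCuspidal)
    (hC : Literature.NumberTheory.Automorphic.bianchi_boundaryEigensystem_isReducible)
    (F : Type) [Field F] [NumberField F] (hF : IsTotallyComplex F) (hdeg : Module.finrank ℚ F = 2)
    (p : ℕ) [Fact p.Prime] (hp : p ≠ 2) (hcpt : isCompact_glFiniteIntegralLevel 2 F) (ι : PadicAlgCl p ≃+* ℂ)
    (ρ : FramedGaloisRep F (PadicAlgCl p) 2) (𝒰 : TameLevel 2 F p)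
    (x : OrdinaryHeckeAlgebraGLn 𝒰 →+* PadicAlgCl p) (k m : ℕ)
    (hirr : ρ.toGaloisRep.IsIrreducible) (h𝒰 : 𝒰.IsMaximalAbove) (hx : Continuous x)
    (hass : 𝒰.IsOrdAssociated x ρ) (hk : 2 ≤ k) (hm : 0 < m)
    (hv : ∀ v : HeightOneSpectrum (𝓞 F), (p : 𝓞 F) ∈ v.asIdeal → ρ.IsOrdinaryOfWeightAt p v k m)
    (hslot : ∃ N : ℕ, 0 < N ∧ ∀ (u : 𝓞 F)
      (û : ∀ v : HeightOneSpectrum (𝓞 F), (p : 𝓞 F) ∈ v.asIdeal → (v.adicCompletionIntegers F)ˣ),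
      (∀ (v : HeightOneSpectrum (𝓞 F)) (hv : (p : 𝓞 F) ∈ v.asIdeal),
          ((û v hv : v.adicCompletionIntegers F) : v.adicCompletion F) =
            algebraMap F (v.adicCompletion F) (u : F)) →
      (∏ᶠ v : {v : HeightOneSpectrum (𝓞 F) // (p : 𝓞 F) ∈ v.asIdeal},
          x (𝒰.ordDiamond v.2 (Pi.mulSingle (0 : Fin 2) (û v.1 v.2)))) ^ N = 1) :
    ∃ π : CuspidalAutomorphicRepData 2 F hcpt, π.1.IsLAlgebraic ∧
      ∀ᶠ v in cofinite, Summit.Langlands.SatakeFrobCompatibleAt ι π.1 ρ v := by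
  have hcen := stub_centralDiamondWeight F hF hdeg p hp ρ 𝒰 x k m hirr h𝒰 hx hass hk hm hv
  exact classical_of_dominantDiamondWeightPoint hA hB hC F hF hdeg p hp hcpt ι ρ 𝒰 x k m hirr h𝒰 hx hass hk hm hv
    (stub_dominantOfCentralAndSlotZero F p 𝒰 x k h𝒰 hcen hslot)

/-- **The crux from (OF⁺) and the three printed Bianchi facts.**  If every irreducible, a.e. unramified, `p`-adically
automorphic `ρ : Γ_F → GL₂(ℚ̄_p)` (`F` imaginary quadratic, `p` odd) that is ordinary of one parallel weight `k ≥ 2` with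
exponent `m > 0` at every `v ∣ p` is associated with a continuous `ℚ̄_p`-point of Hida's ordinary big Hecke algebra at a
tame level maximal above `p` whose slot-`0` diamond character has finite order on global units above `p` — the transfer
statement (OF⁺), the line's registered open stub, written out as the hypothesis `hOF` and NOT asserted — then
`ProModularOrdinaryClassical` holds, granting the three facts.  This is the line's composition with its landed stubs
inlined; it records in the tree that (OF⁺) is the crux's entire open content besides printed literature.
[cite: SkinnerWiles1999, §3, Prop. 3.7] [cite: KhareThorne2017, §6.5, Conj. 6.18] -/
theorem proModularOrdinaryClassical_of_ordinaryFactorisationDominant : Literature.NumberTheory.Automorphic.hidaControl_dominantOrdinaryPoint → Literature.NumberTheory.Automorphic.bianchi_interiorEigenclass_isCuspidal → Literature.NumberTheory.Automorphic.bianchi_boundaryEigensystem_isReducible → (∀ (F : Type) [Field F] [NumberField F], NumberField.IsTotallyComplex F → Module.finrank ℚ F = 2 → ∀ (p : ℕ) [Fact p.Prime], p ≠ 2 → ∀ (ρ : Literature.NumberTheory.GaloisRepresentations.FramedGaloisRep F (PadicAlgCl p) 2) (k m : ℕ), ρ.toGaloisRep.IsIrreducible → (∀ᶠ v in Filter.cofinite,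 ρ.IsUnramifiedAt v) → (∃ 𝒰 : Literature.NumberTheory.Automorphic.BigHeckeGLn.TameLevel 2 F p, 𝒰.IsPadicallyAutomorphic ρ) → 2 ≤ k → 0 < m → (∀ v : IsDedekindDomain.HeightOneSpectrum (NumberField.RingOfIntegers F), (p : NumberField.RingOfIntegers F) ∈ v.asIdeal → ρ.IsOrdinaryOfWeightAt p v k m) → ∃ 𝒰 : Literature.NumberTheory.Automorphic.BigHeckeGLn.TameLevel 2 F p, 𝒰.IsMaximalAbove ∧ ∃ x : Literature.NumberTheory.Automorphic.OrdinaryHeckeAlgebraGLn 𝒰 →+* PadicAlgCl p, Continuous x ∧ 𝒰.IsOrdAssociated x ρ ∧ ∃ N : ℕ, 0 < N ∧ ∀ (u : NumberField.RingOfIntegers F) (û : ∀ v : IsDedekindDomain.HeightOneSpectrum (NumberField.RingOfIntegers F), (p : NumberField.RingOfIntegers F) ∈ v.asIdeal → (v.adicCompletionIntegers F)ˣ), (∀ (v : IsDedekindDomain.HeightOneSpectrum (NumberField.RingOfIntegers F)) (hv : (p : NumberField.RingOfIntegers F) ∈ v.asIdeal), ((û v hv : v.adicCompletionIntegers F) :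 v.adicCompletion F) = algebraMap F (v.adicCompletion F) (u : F)) → (∏ᶠ v : {v : IsDedekindDomain.HeightOneSpectrum (NumberField.RingOfIntegers F) // (p : NumberField.RingOfIntegers F) ∈ v.asIdeal}, x (𝒰.ordDiamond v.2 (Pi.mulSingle (0 : Fin 2) (û v.1 v.2)))) ^ N = 1) → Summit.Langlands.Langlands.Theses.SkinnerWilesDefectOne.ProModularOrdinaryClassical := by
  intro hA hB hC hOF F _ _ hF hdeg p _ hp hcpt ι ρ hirr hunr hpm hord
  obtain ⟨k, hk, m, hm, hv⟩ := hord
  obtain ⟨𝒰, h𝒰, x, hx, hass, hslot⟩ := hOF F hF hdeg p hp ρ k m hirr hunr hpm hk hm hv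
  exact classical_of_slotZeroFiniteOrdinaryPoint hA hB hC F hF hdeg p hp hcpt ι ρ 𝒰 x k m hirr h𝒰 hx hass hk hm hv
    hslot

end Summit.Langlands.Langlands.Theorems.SkinnerWilesDefectOne.ProModularOrdinaryClassicalExit
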